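import Summits.QuantumFields.YangMills.Theorems.BalabanLadderIRAbstractBasinRung
import Summits.QuantumFields.YangMills.Theorems.BalabanLadderIRColdPurityBridgeRungs
import HarnessLib

/-!
# Diagonal heredity ⇒ the seed `E = BasinRung.ColdExitAt θ` of crux `IR` (stmt-QuantumFields-19354) — the RATCHET, PROVED
# (helper on 19354; kernel content of line `diagonal-heredity`, ideator ym-ir-idea-10 g2; the workfile `Cruxes/IR/Lines/diagonal_heredity.lean`
# 34e1d7ddefd2 carries the same theorems plus the registered-style stubs and the bill `IR_of_stubs` by name)

HONEST FRAMING.  Nothing here proves the Yang–Mills mass gap (Clay), the crux `BalabanLadder.IR`, or `E`; R4 closes only the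
conditional finite-𝕋⁴ rung `BalabanLadder.UV`.  This module proves IMPLICATIONS into the seed `BasinRung.ColdExitAt θ` from route-posited
hypotheses (window seed + diagonal step); it asserts none of them.  No `Theses` conclusion is drawn here (the LEAD's bill `BasinRung.IR_of_exitAt24`
composes `coldExitAt_of_diagonalHeredityMinSC` with `X`, `N`).

OBJECTS (route-posited predicates, per `(G, r)`): `WindowSeedAt r θ β₀ Δ` (every coupling of `[β₀, β₀+Δ]` has a `θ`-pure cold box `L ≥ 8`),
`DiagonalStepAt r θ β₀ Δ` («`θ`-pure `(β, L)` ⇒ `θ`-pure `(β + Δ, L')` for some `L' ∈ [8, 2L]`», all `β ≥ β₀`: one increment of inverse coupling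
costs at most one OCTAVE of box), its robust form `DiagonalStepMinAt` (asked only at the purity length), `DiagonalHeredity(Min)At r θ`, and the
class-level `DiagonalHeredity(Min)SC θ` on `E`'s class (compact simple simply-connected `G`, every lattice representation).

CONTENT (sorry-free):
* §2 `ratchet`, `exitBody_of_diagonalHeredityAt` — `W ∧ D ⇒ ∀ β ≥ β₀, ∃ L ≥ 8, δᶜ_β(L) ≤ θ` (Archimedean induction, `k = ⌊(β−β₀)/Δ⌋₊` steps),
  with the GROWTH CEILING `exitScale_le_of_diagonal`: witnesses of size `≤ 2^k · L₁` — «`L*(β) ≤ C · 2^{(β−β₀)/Δ}`», the asymptotic-freedom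
  octave typed on the IR side (AF saturates it: `L* ≍ e^{β/(8b₀)}` forces `Δ ≤ 8 b₀ ln 2`);
* §3 `windowSeedAt_strongCoupling` — on the strong-coupling window `[r_ρ − Δ, r_ρ]` (`r_ρ = Missing.strongCouplingRadius`) the window seed is the
  TREE theorem `ColdPurityBridge.coldExit_uniform_of_strongCoupling` (uniform box `8k₁`), hence `exitBody_of_strongSeededStep`: the diagonal step
  from the strong-coupling window ALONE implies the body of `E` (one hypothesis), with `exitScale_le_of_strongSeededStep`;
* §4 `octaveFreeStep_of_exitBody` — the COSTUME LEMMA: the octave-FREE step is implied by the body of `E` itself, so all content of `D` beyond `E`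
  sits in the octave bound `L' ≤ 2L`; §4b the robust form: `exists_min_pure`, `exitBody_of_windowSeed_minStep`, `exitBody_of_diagonalHeredityMinAt`;
* §5 class level: `diagonalHeredityMinSC_of_SC`, `coldExitAt_of_diagonalHeredityMinSC : DiagonalHeredityMinSC θ → BasinRung.ColdExitAt θ`,
  `coldExitAt_of_diagonalHereditySC`.

GROUP SENSITIVITY (lens «negation», prose): `W ∧ D` seeded at strong coupling is FALSE at `U(1)₄` (the ratchet would cross `β_c ≈ 1.01` into the
Coulomb phase, where no box is pure: `ColdExitSC/Negative/ColdExitFalseOfLightFlux`) and at `SO(3)` (light `ℤ₂` flux) — the hypothesis is not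
group-blind; and strong-seeded `D` is false for `(G, r)` with a first-order BULK transition on the Wilson axis (e.g. `SU(N ≥ 4)` fundamental), which
is why the class-level predicate keeps `β₀(G, r)` free.  FIXED-L upward heredity in `β` is refuted by the femto wall (`ColdExitSC/Negative/
UniformExitFalseOfFemtoTower`, if landed; workfile `Cruxes/IR/Lines/femto_wall.lean`): the diagonal is the only upward direction left.

Refs: Creutz, Phys. Rev. D21 (1980) 2308; Montvay–Münster (1994) §3.7 p.162, (3.267) p.138; Kotecký–Preiss strong-coupling rung as landed in
`Theorems/BalabanLadderIRColdPurityBridgeRungs.lean`.  Tree: `ColdPurityBridge.{coldDefect, coldExit_uniform_of_strongCoupling}`,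
`Balaban1983to89.Missing.strongCouplingRadius`, `BasinRung.ColdExitAt`.
-/

noncomputable section

open MeasureTheory Filter Topology
open Literature.MathematicalPhysics.QuantumFieldTheory Literature.MathematicalPhysics.QuantumLattice
open Literature.MathematicalPhysics.QuantumFieldTheory.Balaban1983to89.Missing (strongCouplingRadius
  strongCouplingRadius_pos)
open Summit.QuantumFields.YangMills.Cruxes.IR.ColdPurityBridge (coldDefect coldExit_uniform_of_strongCoupling)
open Summit.QuantumFields.YangMills.Cruxes.IR.BasinRung (ColdExitAt)

namespace Summit.QuantumFields.YangMills.Cruxes.IR.DiagonalHeredity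

/-! ## §1 Definitions -/

section PerRep

variable {G : Type} [Group G] [TopologicalSpace G] [IsTopologicalGroup G] [CompactSpace G]
  [MeasurableSpace G] [BorelSpace G]

/-- **Window seed** `W(θ, β₀, Δ)` at `(G, r)`: every coupling of the compact window `[β₀, β₀ + Δ]` has a `θ`-pure cold
box `L ≥ 8`.  (On the strong-coupling window a tree theorem: `windowSeedAt_strongCoupling`.) -/
def WindowSeedAt (r : LatticeRep G) (θ β₀ Δ : ℝ) : Prop :=
  ∀ β : ℝ, β₀ ≤ β → β ≤ β₀ + Δ → ∃ L : ℕ, 8 ≤ L ∧ coldDefect r.ρ β L ≤ θ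

/-- **Diagonal step** `D(θ, β₀, Δ)` at `(G, r)` — the LOAD: beyond `β₀`, a `θ`-pure box `L` at coupling `β` forces a
`θ`-pure box `L' ∈ [8, 2L]` at coupling `β + Δ` («one increment `Δ` of inverse coupling costs at most one octave of box»;
the RG reading: `(β + Δ, 2L)` and `(β, L)` are the same physical box when `a(β+Δ) = a(β)/2`). -/
def DiagonalStepAt (r : LatticeRep G) (θ β₀ Δ : ℝ) : Prop :=
  ∀ β : ℝ, β₀ ≤ β → ∀ L : ℕ, 8 ≤ L → coldDefect r.ρ β L ≤ θ →
    ∃ L' : ℕ, 8 ≤ L' ∧ L' ≤ 2 * L ∧ coldDefect r.ρ (β + Δ) L' ≤ θ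

/-- **Diagonal heredity** at `(G, r)`: some window seed and the diagonal step with a common `(β₀, Δ)`, `Δ > 0`. -/
def DiagonalHeredityAt (r : LatticeRep G) (θ : ℝ) : Prop :=
  ∃ β₀ Δ : ℝ, 0 < Δ ∧ WindowSeedAt r θ β₀ Δ ∧ DiagonalStepAt r θ β₀ Δ

/-! ## §2 The ratchet (PROVED): `W ∧ D ⇒` the body of `E`, with witnesses `≤ 2^k · L'` -/

/-- The induction: from the window, `k` diagonal steps reach `β + kΔ` with a pure box of size `≤ 2^k · L` for some seed box `L`. -/
theorem ratchet (r : LatticeRep G) {θ β₀ Δ : ℝ} (hΔ : 0 < Δ) (hW : WindowSeedAt r θ β₀ Δ)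
    (hD : DiagonalStepAt r θ β₀ Δ) (k : ℕ) :
    ∀ β : ℝ, β₀ ≤ β → β ≤ β₀ + Δ →
      ∃ L₀ : ℕ, 8 ≤ L₀ ∧ coldDefect r.ρ β L₀ ≤ θ ∧
        ∃ L : ℕ, 8 ≤ L ∧ L ≤ 2 ^ k * L₀ ∧ coldDefect r.ρ (β + k * Δ) L ≤ θ := by
  induction k with
  | zero =>
    intro β hβ hβ'
    obtain ⟨L, hL, hδ⟩ := hW β hβ hβ'
    exact ⟨L, hL, hδ, L, hL, by simp, by simpa using hδ⟩
  | succ k ih =>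
    intro β hβ hβ'
    obtain ⟨L₀, hL₀, hδ₀, L, hL, hLle, hδ⟩ := ih β hβ hβ'
    have hβk : β₀ ≤ β + k * Δ := by
      have : (0 : ℝ) ≤ k * Δ := mul_nonneg (Nat.cast_nonneg k) hΔ.le
      linarith
    obtain ⟨L', hL', hL'le, hδ'⟩ := hD (β + k * Δ) hβk L hL hδ
    refine ⟨L₀, hL₀, hδ₀, L', hL', ?_, ?_⟩
    · calc L' ≤ 2 * L := hL'le
        _ ≤ 2 * (2 ^ k * L₀) := Nat.mul_le_mul_left 2 hLle
        _ = 2 ^ (k + 1) * L₀ := by ring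
    · have : β + ((k + 1 : ℕ) : ℝ) * Δ = β + k * Δ + Δ := by push_cast; ring
      rw [this]
      exact hδ'

/-- **`W ∧ D ⇒` the body of `E` at `(G, r)`** (PROVED): every `β ≥ β₀` has a `θ`-pure cold box `L ≥ 8`. -/
theorem exitBody_of_diagonalHeredityAt (r : LatticeRep G) {θ : ℝ} (h : DiagonalHeredityAt r θ) :
    ∃ β₁ : ℝ, ∀ β : ℝ, β₁ ≤ β → ∃ L : ℕ, 8 ≤ L ∧ coldDefect r.ρ β L ≤ θ := by
  obtain ⟨β₀, Δ, hΔ, hW, hD⟩ := h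
  refine ⟨β₀, fun β hβ => ?_⟩
  set k : ℕ := ⌊(β - β₀) / Δ⌋₊ with hk
  have hx : 0 ≤ (β - β₀) / Δ := div_nonneg (by linarith) hΔ.le
  have h1 : (k : ℝ) ≤ (β - β₀) / Δ := Nat.floor_le hx
  have h2 : (β - β₀) / Δ < k + 1 := Nat.lt_floor_add_one _
  have h1' : (k : ℝ) * Δ ≤ β - β₀ := by rwa [le_div_iff₀ hΔ] at h1
  have h2' : β - β₀ < (k + 1) * Δ := by rwa [div_lt_iff₀ hΔ] at h2
  obtain ⟨L₀, -, -, L, hL, -, hδ⟩ :=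
    ratchet r hΔ hW hD k (β - k * Δ) (by linarith) (by nlinarith)
  refine ⟨L, hL, ?_⟩
  have : β - k * Δ + k * Δ = β := by ring
  rwa [this] at hδ

/-- **Growth ceiling of the purity length** (PROVED): under `W ∧ D`, if the seed window has pure boxes of size `≤ L₁`, then
at `β ∈ [β₀ + kΔ, β₀ + (k+1)Δ]` a pure box of size `≤ 2^k · L₁` exists — the exit scale grows at most like `2^{(β−β₀)/Δ}`.
(Asymptotic freedom saturates this: `L*(β) ≍ 1/a(β) ≍ e^{β/(8b₀)}` for `SU(2)`, so `D` forces `Δ ≤ 8b₀ ln 2`.) -/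
theorem exitScale_le_of_diagonal (r : LatticeRep G) {θ β₀ Δ : ℝ} (hΔ : 0 < Δ) {L₁ : ℕ}
    (hW : ∀ β : ℝ, β₀ ≤ β → β ≤ β₀ + Δ → ∃ L : ℕ, 8 ≤ L ∧ L ≤ L₁ ∧ coldDefect r.ρ β L ≤ θ)
    (hD : DiagonalStepAt r θ β₀ Δ) (k : ℕ) :
    ∀ β : ℝ, β₀ ≤ β → β ≤ β₀ + Δ →
      ∃ L : ℕ, 8 ≤ L ∧ L ≤ 2 ^ k * L₁ ∧ coldDefect r.ρ (β + k * Δ) L ≤ θ := by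
  induction k with
  | zero =>
    intro β hβ hβ'
    obtain ⟨L, hL, hL₁, hδ⟩ := hW β hβ hβ'
    exact ⟨L, hL, by simpa using hL₁, by simpa using hδ⟩
  | succ k ih =>
    intro β hβ hβ'
    obtain ⟨L, hL, hLle, hδ⟩ := ih β hβ hβ'
    have hβk : β₀ ≤ β + k * Δ := by
      have : (0 : ℝ) ≤ k * Δ := mul_nonneg (Nat.cast_nonneg k) hΔ.le
      linarith
    obtain ⟨L', hL', hL'le, hδ'⟩ := hD (β + k * Δ) hβk L hL hδ
    refine ⟨L', hL', ?_, ?_⟩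
    · calc L' ≤ 2 * L := hL'le
        _ ≤ 2 * (2 ^ k * L₁) := Nat.mul_le_mul_left 2 hLle
        _ = 2 ^ (k + 1) * L₁ := by ring
    · have : β + ((k + 1 : ℕ) : ℝ) * Δ = β + k * Δ + Δ := by push_cast; ring
      rw [this]
      exact hδ'

/-! ## §3 The strong-coupling seed is a TREE THEOREM (every compact `G`) -/

/-- **Window seed on the strong-coupling window (PROVED, group-blind)**: for `0 < θ` and `Δ ≤ r_ρ`
(`r_ρ = strongCouplingRadius r.ρ`), the window `[r_ρ − Δ, r_ρ]` is seeded, with boxes of ONE size `8k₁(θ)` —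
`ColdPurityBridge.coldExit_uniform_of_strongCoupling` (Kotecký–Preiss polymer gas of the periodic boxes). -/
theorem windowSeedAt_strongCoupling (r : LatticeRep G) {θ Δ : ℝ} (hθ : 0 < θ)
    (hΔr : Δ ≤ strongCouplingRadius r.ρ) :
    ∃ L₁ : ℕ, 8 ≤ L₁ ∧ ∀ β : ℝ, strongCouplingRadius r.ρ - Δ ≤ β → β ≤ strongCouplingRadius r.ρ - Δ + Δ →
      ∃ L : ℕ, 8 ≤ L ∧ L ≤ L₁ ∧ coldDefect r.ρ β L ≤ θ := by
  obtain ⟨k₁, hk₁, h⟩ := coldExit_uniform_of_strongCoupling r hθ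
  refine ⟨8 * k₁, by omega, fun β hβ hβ' => ⟨8 * k₁, by omega, le_rfl, h β (by linarith) (by linarith) k₁ le_rfl⟩⟩

/-- **ONE hypothesis gives the body of `E` (PROVED): the diagonal step from the strong-coupling window.**  If `D(θ, r_ρ − Δ, Δ)`
holds at `(G, r)` for some `0 < Δ ≤ r_ρ`, then every `β ≥ r_ρ − Δ` has a `θ`-pure cold box — the seed is the tree's
strong-coupling rung.  (Physically right for `SU(2)`, `SU(3)` fundamental; FALSE for `(G, r)` with a first-order bulk
transition on the Wilson axis — see the header; hence the class-level stub keeps `β₀` free.) -/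
theorem exitBody_of_strongSeededStep (r : LatticeRep G) {θ Δ : ℝ} (hθ : 0 < θ) (hΔ : 0 < Δ)
    (hΔr : Δ ≤ strongCouplingRadius r.ρ)
    (hD : DiagonalStepAt r θ (strongCouplingRadius r.ρ - Δ) Δ) :
    ∃ β₁ : ℝ, ∀ β : ℝ, β₁ ≤ β → ∃ L : ℕ, 8 ≤ L ∧ coldDefect r.ρ β L ≤ θ := by
  obtain ⟨L₁, -, hW⟩ := windowSeedAt_strongCoupling r hθ hΔr
  exact exitBody_of_diagonalHeredityAt r
    ⟨strongCouplingRadius r.ρ - Δ, Δ, hΔ, fun β hβ hβ' => by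
      obtain ⟨L, hL, -, hδ⟩ := hW β hβ hβ'
      exact ⟨L, hL, hδ⟩, hD⟩

/-- **Growth ceiling from strong coupling (PROVED)**: under the strong-seeded step, at `β = r_ρ − Δ + s + kΔ`, `s ∈ [0, Δ]`,
a `θ`-pure box of size `≤ 2^k · 8k₁(θ)` exists — purity length `≤ C(θ, r) · 2^{β/Δ}` along the whole Wilson axis. -/
theorem exitScale_le_of_strongSeededStep (r : LatticeRep G) {θ Δ : ℝ} (hθ : 0 < θ) (hΔ : 0 < Δ)
    (hΔr : Δ ≤ strongCouplingRadius r.ρ)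
    (hD : DiagonalStepAt r θ (strongCouplingRadius r.ρ - Δ) Δ) :
    ∃ L₁ : ℕ, 8 ≤ L₁ ∧ ∀ k : ℕ, ∀ β : ℝ, strongCouplingRadius r.ρ - Δ ≤ β → β ≤ strongCouplingRadius r.ρ →
      ∃ L : ℕ, 8 ≤ L ∧ L ≤ 2 ^ k * L₁ ∧ coldDefect r.ρ (β + k * Δ) L ≤ θ := by
  obtain ⟨L₁, hL₁, hW⟩ := windowSeedAt_strongCoupling r hθ hΔr
  exact ⟨L₁, hL₁, fun k β hβ hβ' =>
    exitScale_le_of_diagonal r hΔ hW hD k β hβ (by linarith)⟩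

/-! ## §4 Why the octave bound is the content (PROVED): the octave-FREE step is an `E`-costume -/

/-- **The octave-free step is implied by the body of `E`** (PROVED): if every `β ≥ β₁` has a pure box, then trivially
«a pure box at `β` ⇒ a pure box at `β + Δ`» for `β ≥ β₁`, `Δ ≥ 0`.  So the statement WITHOUT `L' ≤ 2L` would be equivalent to
`E` given the seed (a costume); the diagonal step's content is exactly the octave bound = the RG rate. -/
theorem octaveFreeStep_of_exitBody (r : LatticeRep G) {θ β₁ Δ : ℝ} (hΔ : 0 ≤ Δ)
    (hE : ∀ β : ℝ, β₁ ≤ β → ∃ L : ℕ, 8 ≤ L ∧ coldDefect r.ρ β L ≤ θ) :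
    ∀ β : ℝ, β₁ ≤ β → (∃ L : ℕ, 8 ≤ L ∧ coldDefect r.ρ β L ≤ θ) →
      ∃ L' : ℕ, 8 ≤ L' ∧ coldDefect r.ρ (β + Δ) L' ≤ θ :=
  fun β hβ _ => hE (β + Δ) (by linarith [hΔ])

/-! ## §4b The robust form (PROVED seams): ask the step only at the PURITY LENGTH -/

/-- **Minimal diagonal step** `D_min(θ, β₀, Δ)`: the octave step is asked only at the LEAST `θ`-pure size `L` at coupling `β`
(every `8 ≤ L'' < L` impure) — immune to «accidentally pure» small boxes in a non-monotone crossover.  Weaker than `D`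
(`diagonalStepMinAt_of_diagonalStepAt`); same ratchet (`exitBody_of_windowSeed_minStep`). -/
def DiagonalStepMinAt (r : LatticeRep G) (θ β₀ Δ : ℝ) : Prop :=
  ∀ β : ℝ, β₀ ≤ β → ∀ L : ℕ, 8 ≤ L → coldDefect r.ρ β L ≤ θ →
    (∀ L'' : ℕ, 8 ≤ L'' → L'' < L → θ < coldDefect r.ρ β L'') →
    ∃ L' : ℕ, 8 ≤ L' ∧ L' ≤ 2 * L ∧ coldDefect r.ρ (β + Δ) L' ≤ θ

/-- The plain diagonal step implies its robust (`min`) form: `DiagonalStepAt r θ β₀ Δ → DiagonalStepMinAt r θ β₀ Δ`. -/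
theorem diagonalStepMinAt_of_diagonalStepAt (r : LatticeRep G) {θ β₀ Δ : ℝ} (h : DiagonalStepAt r θ β₀ Δ) :
    DiagonalStepMinAt r θ β₀ Δ :=
  fun β hβ L hL hδ _ => h β hβ L hL hδ

/-- From ANY pure box to the LEAST pure box (classical `Nat.find`). -/
theorem exists_min_pure (r : LatticeRep G) {θ β : ℝ} (h : ∃ L : ℕ, 8 ≤ L ∧ coldDefect r.ρ β L ≤ θ) :
    ∃ L : ℕ, 8 ≤ L ∧ coldDefect r.ρ β L ≤ θ ∧ ∀ L'' : ℕ, 8 ≤ L'' → L'' < L → θ < coldDefect r.ρ β L'' := by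
  classical
  refine ⟨Nat.find h, (Nat.find_spec h).1, (Nat.find_spec h).2, fun L'' hL'' hlt => ?_⟩
  have := Nat.find_min h hlt
  push Not at this
  exact this hL''

/-- **The robust ratchet (PROVED)**: `W ∧ D_min ⇒` the body of `E` at `(G, r)`. -/
theorem exitBody_of_windowSeed_minStep (r : LatticeRep G) {θ β₀ Δ : ℝ} (hΔ : 0 < Δ) (hW : WindowSeedAt r θ β₀ Δ)
    (hD : DiagonalStepMinAt r θ β₀ Δ) :
    ∃ β₁ : ℝ, ∀ β : ℝ, β₁ ≤ β → ∃ L : ℕ, 8 ≤ L ∧ coldDefect r.ρ β L ≤ θ := by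
  -- induction along the grid, carrying only existence of a pure box
  have step : ∀ k : ℕ, ∀ β : ℝ, β₀ ≤ β → β ≤ β₀ + Δ →
      ∃ L : ℕ, 8 ≤ L ∧ coldDefect r.ρ (β + k * Δ) L ≤ θ := by
    intro k
    induction k with
    | zero =>
      intro β hβ hβ'
      obtain ⟨L, hL, hδ⟩ := hW β hβ hβ'
      exact ⟨L, hL, by simpa using hδ⟩
    | succ k ih =>
      intro β hβ hβ'
      obtain ⟨L, hL, hδ, hmin⟩ := exists_min_pure r (ih β hβ hβ')
      have hβk : β₀ ≤ β + k * Δ := by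
        have : (0 : ℝ) ≤ k * Δ := mul_nonneg (Nat.cast_nonneg k) hΔ.le
        linarith
      obtain ⟨L', hL', -, hδ'⟩ := hD (β + k * Δ) hβk L hL hδ hmin
      refine ⟨L', hL', ?_⟩
      have : β + ((k + 1 : ℕ) : ℝ) * Δ = β + k * Δ + Δ := by push_cast; ring
      rw [this]
      exact hδ'
  refine ⟨β₀, fun β hβ => ?_⟩
  set k : ℕ := ⌊(β - β₀) / Δ⌋₊ with hk
  have hx : 0 ≤ (β - β₀) / Δ := div_nonneg (by linarith) hΔ.le
  have h1 : (k : ℝ) ≤ (β - β₀) / Δ := Nat.floor_le hx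
  have h2 : (β - β₀) / Δ < k + 1 := Nat.lt_floor_add_one _
  have h1' : (k : ℝ) * Δ ≤ β - β₀ := by rwa [le_div_iff₀ hΔ] at h1
  have h2' : β - β₀ < (k + 1) * Δ := by rwa [div_lt_iff₀ hΔ] at h2
  obtain ⟨L, hL, hδ⟩ := step k (β - k * Δ) (by linarith) (by nlinarith)
  refine ⟨L, hL, ?_⟩
  have : β - k * Δ + k * Δ = β := by ring
  rwa [this] at hδ

/-- **Robust diagonal heredity** at `(G, r)`: window seed + MINIMAL diagonal step, common `(β₀, Δ)`. -/
def DiagonalHeredityMinAt (r : LatticeRep G) (θ : ℝ) : Prop :=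
  ∃ β₀ Δ : ℝ, 0 < Δ ∧ WindowSeedAt r θ β₀ Δ ∧ DiagonalStepMinAt r θ β₀ Δ

/-- Diagonal heredity implies its robust (`min`) form at `(G, r)`. -/
theorem diagonalHeredityMinAt_of_diagonalHeredityAt (r : LatticeRep G) {θ : ℝ} (h : DiagonalHeredityAt r θ) :
    DiagonalHeredityMinAt r θ := by
  obtain ⟨β₀, Δ, hΔ, hW, hD⟩ := h
  exact ⟨β₀, Δ, hΔ, hW, diagonalStepMinAt_of_diagonalStepAt r hD⟩

/-- **The ratchet, robust form**: `DiagonalHeredityMinAt r θ` gives the body of the seed — beyond some `β₁`, every `β` has a cold box `L ≥ 8` with `coldDefect ≤ θ`. -/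
theorem exitBody_of_diagonalHeredityMinAt (r : LatticeRep G) {θ : ℝ} (h : DiagonalHeredityMinAt r θ) :
    ∃ β₁ : ℝ, ∀ β : ℝ, β₁ ≤ β → ∃ L : ℕ, 8 ≤ L ∧ coldDefect r.ρ β L ≤ θ := by
  obtain ⟨β₀, Δ, hΔ, hW, hD⟩ := h
  exact exitBody_of_windowSeed_minStep r hΔ hW hD

end PerRep

/-! ## §5 Class level and the bill -/

/-- **`DiagonalHereditySC θ` — the engine-facing (stronger) class-level form**: for every compact simple simply-connected
`G` and every lattice representation, diagonal heredity at tolerance `θ` — a window seed `[β₀, β₀ + Δ]` and the diagonal step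
«`θ`-pure `(β, L)` ⇒ `θ`-pure `(β + Δ, L')` for some `L' ∈ [8, 2L]`» for all `β ≥ β₀`, with `β₀ = β₀(G, r)` beyond the
lattice-artefact bulk transitions and `0 < Δ = Δ(G, r)` at most one octave of asymptotic-freedom running (`≤ 8b₀ ln 2` in
`β = 2N/g²` units).  Content: confinement persistence across the crossover («no deconfining bulk transition») + the AF octave
rate; FALSE at `U(1)₄` (Coulomb phase beyond `β_c`) and at `SO(3)` (light `ℤ₂` flux) — group-sensitive as the lens demands.
Why it might fail as typed: a box `θ`-pure «by accident» far below the purity length (non-monotone `L ↦ δᶜ_β(L)` in the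
femto ∕ deconfinement crossover of the `L/4`-box) need not have a pure partner `≤ 2L` one increment later — the LOAD below
(`DiagonalHeredityMinSC`) therefore asks the step only at the purity length.  Route-posited (no literature statement). -/
def DiagonalHereditySC (θ : ℝ) : Prop :=
  ∀ (G : Type) [Group G] [TopologicalSpace G] [IsTopologicalGroup G] [CompactSpace G],
    IsCompactSimpleLieGroup G → SimplyConnectedSpace G →
    letI : MeasurableSpace G := borel G
    haveI : BorelSpace G := ⟨rfl⟩
    ∀ r : LatticeRep G, DiagonalHeredityAt r θ

/-- **STUB ∕ CRUX `DiagonalHeredityMinSC θ` (NEW, the LOAD of this line)**: as `DiagonalHereditySC` but the octave step is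
asked only at the PURITY LENGTH `L*(β)` (the least `θ`-pure size): «`L*(β + Δ) ≤ 2·L*(β)` for all `β ≥ β₀(G, r)`» together
with one seeded window.  Equivalent wording: the purity length at tolerance `θ` at most DOUBLES per coupling increment `Δ`.
Weaker than `DiagonalHereditySC` (`diagonalHeredityMinSC_of_SC`).  Why it might fail: only if the purity length of `SU(N)`
jumps by more than an octave somewhere beyond every `β₀` — a deconfining or bulk singularity at arbitrarily weak coupling, or
super-AF growth of `L*` (faster than `2^{β/Δ}` for every `Δ > 0`, i.e. faster than exponential in `β` — excluded by two-loop
asymptotic scaling `L* ≍ β^{p} e^{β/(8b₀)}` if scaling holds).  Sources: Creutz, Phys. Rev. D21 (1980) 2308 (SU(2) crossover,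
no bulk transition); Creutz 2022 «Quarks, Gluons and Lattices» p.116; Montvay–Münster (1994) §3.7 p.162 («absence of any bulk
phase transition … widely believed»), (3.267) p.138 (asymptotic scaling).  Route-posited. -/
def DiagonalHeredityMinSC (θ : ℝ) : Prop :=
  ∀ (G : Type) [Group G] [TopologicalSpace G] [IsTopologicalGroup G] [CompactSpace G],
    IsCompactSimpleLieGroup G → SimplyConnectedSpace G →
    letI : MeasurableSpace G := borel G
    haveI : BorelSpace G := ⟨rfl⟩
    ∀ r : LatticeRep G, DiagonalHeredityMinAt r θ

/-- Class level: `DiagonalHereditySC θ → DiagonalHeredityMinSC θ`. -/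
theorem diagonalHeredityMinSC_of_SC {θ : ℝ} (h : DiagonalHereditySC θ) : DiagonalHeredityMinSC θ := by
  intro G _ _ _ _ hG hsc
  letI : MeasurableSpace G := borel G
  haveI : BorelSpace G := ⟨rfl⟩
  intro r
  exact diagonalHeredityMinAt_of_diagonalHeredityAt r (h G hG hsc r)

/-- **`DiagonalHeredityMinSC θ → ColdExitAt θ`** (PROVED): the robust ratchet at every `(G, r)` of `E`'s class. -/
theorem coldExitAt_of_diagonalHeredityMinSC {θ : ℝ} (h : DiagonalHeredityMinSC θ) : ColdExitAt θ := by
  intro G _ _ _ _ hG hsc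
  letI : MeasurableSpace G := borel G
  haveI : BorelSpace G := ⟨rfl⟩
  intro r
  exact exitBody_of_diagonalHeredityMinAt r (h G hG hsc r)

/-- **`DiagonalHereditySC θ → ColdExitAt θ`** (PROVED). -/
theorem coldExitAt_of_diagonalHereditySC {θ : ℝ} (h : DiagonalHereditySC θ) : ColdExitAt θ :=
  coldExitAt_of_diagonalHeredityMinSC (diagonalHeredityMinSC_of_SC h)

end Summit.QuantumFields.YangMills.Cruxes.IR.DiagonalHeredity

end
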